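import Summits.QuantumFields.YangMills.Theorems.BalabanLadderIRReflectedAntipodal
import Summits.QuantumFields.YangMills.Theorems.BalabanLadderIRRankPurityCofinal
import Summits.QuantumFields.YangMills.Theorems.BalabanLadderIRColdPressurePincer
import Summits.QuantumFields.YangMills.Theorems.DoublingDefectRecursionToGapIteration
import HarnessLib

/-!
# Crux `BalabanLadder.IR` ∕ `IRcof` (stmt-QuantumFields-19354 ∕ 26930) — LINE E «antipodal code»: statements, proved seams, compositions
# (ideator ym-ir-idea-14 gen 4; lens strengthen-to-induct; verdicts crit-4 VERDICT-antipodal-code PASS-WITH-PRICE, crit-1 V24)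

HONEST STATUS.  Nothing here proves `BalabanLadder.IR` (19354), `IRcof` (26930), `IRnsc`, `IRnscCof`, ANTI, any lattice mass gap
or the Clay Yang–Mills problem; R4 = the conditional finite-𝕋⁴ rung `BalabanLadder.UV` only; IR 0/1, IRcof 0/1, legs 0/6.

REV 4 = THE LINE AFTER PART R (landed `Theorems/BalabanLadderIRReflectedAntipodal.lean`, p627475): the crux's conclusion `GapInUnits`
IS reflected antipodal mirror decay (`gapInUnits_iff_reflectedAntipodal`, `IR_iff_reflected`, `IRnsc_iff_reflected` — the in-tree
solo-blind rung D8 single-torus RP reduction re-run with a rate-uniform constant).  Hence the residual of record N (`IRnsc`) ⟺ ANTI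
(`anti_iff_irnsc` below, PROVED), and the FRAME ∕ ANTICODE seams and the J ∧ Xᴷ inputs of rev 2∕3 (workfile history c5530e62f72e;
model inequality landed as `Theorems/BalabanLadderIRAntipodalCodeCore.lean`, p627370) are NOT NEEDED to reach N from ANTI — superseded.

THE BILL (rev 4): `IRcof ⇐ (K1 ∧ X) ∧ ANTI` (`IRcof_of_anti`; the registered stubs live in the workfile `Cruxes/IR/Lines/antipodal_code.lean`); for the uniform leaf `IR ⇐ IRsc ∧ ANTI`
(`IR_of_sc_anti`; the LEAD's slot {PX, N} is unchanged BY NAME: N ⟺ ANTI).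
* ANTI `AntipodalMirrorDecay` — for compact simple `G` with `π₁ ≠ 1`, floors ⇒ the two reflection correlators of every species at the
  ANTIPODE of the odd tori decay at a pinned rate in floor units, uniformly in `β` (one species, one separation).  NECESSARY
  (`antipodal_of_IR`), ⟺ N (`anti_iff_irnsc`).  Same wall as N (XL) — R re-faces N, it does not cut it.
* THE LENS'S INDUCTIVE CUT: ANTI ⇐ `AntipodalBasin` (typing C′ of crit-4's verdict: ONE entrance per coupling at pinned physical size +
  antipodal squaring under torus doubling FROM THAT ENTRANCE ON), `antipodal_of_basin` PROVED from the landed doubling engine.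
-/

noncomputable section

open Filter Topology MeasureTheory
open Literature.MathematicalPhysics.QuantumFieldTheory Literature.MathematicalPhysics.QuantumLattice
open Summit.QuantumFields.YangMills.Cruxes.OSLegsFromFemtoAndGap.DlrCollarTransfer (GapInUnits LowerBounds)
open Summit.QuantumFields.YangMills.Cruxes.IR.ColdPressurePincer (IRsc IRnsc AFToColdPressure IR_of_cases)
open Summit.QuantumFields.YangMills.Cruxes.IR.ScalingHeredity (CofinalExitAt)
open Summit.QuantumFields.YangMills.Cruxes.IR.RankPurity (IRnscCof IRscCof irnscCof_of_irnsc IRcof_of_split irscCof_of_K1_X)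
open Summit.QuantumFields.YangMills.Cruxes.IR.ReflectedAntipodal
open Summit.QuantumFields.YangMills.Theorems.DoublingDefect (defect_decay_of_recursion)

namespace Summit.QuantumFields.YangMills.Cruxes.IR.AntipodalCode

/-! ## §1 Objects and statements -/

section Defs

variable {G : Type} [Group G] [TopologicalSpace G] [IsTopologicalGroup G] [CompactSpace G]
  [MeasurableSpace G] [BorelSpace G]

/-- **The antipodal mirror correlator** of a species `A` at coupling `β` on the torus `(2S+1)⁴`: the sum of the absolute values of
the two REFLECTION correlators `c_{A,ΘA}(S; S)`, `c_{ΘA,A}(S; S)` at the antipodal time separation `n = S` (`Θ` = site time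
reflection, `SpeciesTimeReflection`; the two orders are the indices `S`, `S+1` of one OS pairing, by going round the torus). -/
def antip (r : LatticeRep G) (β : ℝ) (A : YMSpecies G) (S : ℕ) : ℝ :=
  |latticeConnectedCorr r.ρ β (2 * S + 1) A.F A.timeReflect.F S| +
    |latticeConnectedCorr r.ρ β (2 * S + 1) A.timeReflect.F A.F S|

/-- `antip` is non-negative. -/
theorem antip_nonneg (r : LatticeRep G) (β : ℝ) (A : YMSpecies G) (S : ℕ) : 0 ≤ antip r β A S :=
  add_nonneg (abs_nonneg _) (abs_nonneg _)

end Defs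

/-- **ANTI `AntipodalMirrorDecay` — ANTIPODAL MIRROR DECAY AT A PINNED RATE** (HYPOTHESIS-side `Prop`; open Yang–Mills content).
NECESSARY: it is the conclusion `GapInUnits` of the uniform item `BalabanLadder.IR` restricted to the reflected mirror pairs
`(A, ΘA)`, `(ΘA, A)` at the one separation `n = S` — `antipodal_of_IR`; EQUIVALENT BY PROOF to the residual of record `IRnsc` —
`anti_iff_irnsc` (part R); NOT implied by the cofinal leaf `IRcof` ∕ `IRnscCof` (it is uniform in `β`).  For compact simple `G` with
`π₁(G) ≠ 1`, under the crux's floor hypotheses: a rate `c₁ > 0`, a threshold `β₂` and sizes `S₁(β)` with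
`antip r β A S ≤ C_A e^{−c₁ a(β) S}` for all `β ≥ β₂`, `S ≥ S₁(β)`.  Why it might fail: exactly with N (a massless ∕ deconfined phase,
light electric-flux multiplets for `π₁ ≠ 1`); it is the reflection-positive face of the same wall. -/
def AntipodalMirrorDecay : Prop :=
  ∀ (G : Type) [Group G] [TopologicalSpace G] [IsTopologicalGroup G] [CompactSpace G],
    IsCompactSimpleLieGroup G → ¬ SimplyConnectedSpace G →
    letI : MeasurableSpace G := borel G
    haveI : BorelSpace G := ⟨rfl⟩
    ∀ (r : LatticeRep G) (a : ℝ → ℝ), (∀ β, 0 < a β) → Tendsto a atTop (𝓝 0) → LowerBounds G r a →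
      ∃ (c₁ β₂ : ℝ) (S₁ : ℝ → ℕ), 0 < c₁ ∧ ∀ A : YMSpecies G, ∃ C : ℝ, ∀ β : ℝ, β₂ ≤ β →
        ∀ S : ℕ, S₁ β ≤ S → antip r β A S ≤ C * Real.exp (-(c₁ * a β * S))

/-- **ANTI-BASIN `AntipodalBasin` — the lens's inductive strengthening of ANTI** (HYPOTHESIS-side `Prop`; ONE token, TWO walls; typing C′ of
crit-4's VERDICT-antipodal-code (1): squaring FROM THE ENTRANCE SCALE only — the struck rev-1 shape asked squaring for all `S ≥ S₀` uniformly in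
`β`, false in femto boxes at weak coupling).  A pin `T`, a threshold `β₂`, and per species a constant `C_A > 0` such that every `β ≥ β₂` has an
ENTRANCE scale `S_e ≥ 1` of physical size `a(β) S_e ≤ T` with `antip(S_e) ≤ 1/(16 C_A)` (THE NUMBER, in antipodal currency, uniform in `β`),
from which on ANTIPODAL SQUARING holds: `antip(S') ≤ C_A · antip(S)²` for `S ≥ S_e`, `S' ∈ [2S, 4S]` («on confined boxes the flux multiplet's
code defect is governed by a vortex-sheet AREA law, so it more than squares under doubling; the glueball part squares exactly»).  Why it might
fail: squaring has no spectral proof (a light level makes `antip` plateau) — it bets on the GEOMETRIC `S`-dependence of the light matrix elements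
('t Hooft's `Z_twist/Z → 1` area law); the entrance is a fixed-physical-size statement for all large `β`. -/
def AntipodalBasin : Prop :=
  ∀ (G : Type) [Group G] [TopologicalSpace G] [IsTopologicalGroup G] [CompactSpace G],
    IsCompactSimpleLieGroup G → ¬ SimplyConnectedSpace G →
    letI : MeasurableSpace G := borel G
    haveI : BorelSpace G := ⟨rfl⟩
    ∀ (r : LatticeRep G) (a : ℝ → ℝ), (∀ β, 0 < a β) → Tendsto a atTop (𝓝 0) → LowerBounds G r a →
      ∃ (T β₂ : ℝ), 0 < T ∧ ∀ A : YMSpecies G, ∃ C : ℝ, 0 < C ∧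
        ∀ β : ℝ, β₂ ≤ β → ∃ Se : ℕ, 1 ≤ Se ∧ a β * (Se : ℝ) ≤ T ∧ antip r β A Se ≤ 1 / (16 * C) ∧
          ∀ S : ℕ, Se ≤ S → ∀ S' : ℕ, 2 * S ≤ S' → S' ≤ 4 * S → antip r β A S' ≤ C * antip r β A S ^ 2

/-! ## §2 Proved: necessity of ANTI, ANTI ⟺ N, the inductive cut -/

/-- **ANTI is necessary (PROVED)**: the uniform item `BalabanLadder.IR` implies ANTI (two instances of its clustering family). -/
theorem antipodal_of_IR (hIR : Summit.QuantumFields.YangMills.Theses.BalabanLadder.IR) : AntipodalMirrorDecay := by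
  intro G _ _ _ _ hG _hns
  letI : MeasurableSpace G := borel G
  haveI : BorelSpace G := ⟨rfl⟩
  intro r a ha ha0 hlb
  obtain ⟨c₁, β₂, S₁, hc₁, h⟩ := hIR G hG r a ha ha0 hlb
  refine ⟨c₁, β₂, S₁, hc₁, fun A => ?_⟩
  obtain ⟨C₁, hC₁⟩ := h A A.timeReflect
  obtain ⟨C₂, hC₂⟩ := h A.timeReflect A
  refine ⟨C₁ + C₂, fun β hβ S hS => ?_⟩
  have h1 := hC₁ β hβ S S hS le_rfl
  have h2 := hC₂ β hβ S S hS le_rfl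
  unfold antip
  linarith

/-- **N ⇒ ANTI (PROVED)**: the residual of record `IRnsc` implies ANTI. -/
theorem anti_of_irnsc (hN : IRnsc) : AntipodalMirrorDecay := by
  intro G _ _ _ _ hG hns
  letI : MeasurableSpace G := borel G
  haveI : BorelSpace G := ⟨rfl⟩
  intro r a ha ha0 hlb
  obtain ⟨c₁, β₂, S₁, hc₁, h⟩ := hN G hG hns r a ha ha0 hlb
  refine ⟨c₁, β₂, S₁, hc₁, fun A => ?_⟩
  obtain ⟨C₁, hC₁⟩ := h A A.timeReflect
  obtain ⟨C₂, hC₂⟩ := h A.timeReflect A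
  refine ⟨C₁ + C₂, fun β hβ S hS => ?_⟩
  have h1 := hC₁ β hβ S S hS le_rfl
  have h2 := hC₂ β hβ S S hS le_rfl
  unfold antip
  linarith

/-- **ANTI ⇒ the reflected form of N (PROVED)**: each reflection correlator is bounded by `antip`. -/
theorem irnscRefl_of_anti (hA : AntipodalMirrorDecay) : IRnscRefl := by
  intro G _ _ _ _ hG hns
  letI : MeasurableSpace G := borel G
  haveI : BorelSpace G := ⟨rfl⟩
  intro r a ha ha0 hlb
  obtain ⟨c₁, β₂, S₁, hc₁, h⟩ := hA G hG hns r a ha ha0 hlb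
  refine ⟨c₁, β₂, S₁, hc₁, fun A => ?_⟩
  obtain ⟨C, hC⟩ := h A
  refine ⟨C, fun β hβ S hS => ?_⟩
  have h1 := hC β hβ S hS
  unfold antip at h1
  constructor
  · linarith [le_abs_self (latticeConnectedCorr r.ρ β (2 * S + 1) A.timeReflect.F A.F S),
      abs_nonneg (latticeConnectedCorr r.ρ β (2 * S + 1) A.F A.timeReflect.F S)]
  · linarith [le_abs_self (latticeConnectedCorr r.ρ β (2 * S + 1) A.F A.timeReflect.F S),
      abs_nonneg (latticeConnectedCorr r.ρ β (2 * S + 1) A.timeReflect.F A.F S)]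

/-- **ANTI ⇒ N (PROVED)** — by part R (`IRnsc_iff_reflected`: the solo-blind RP reduction with a rate-uniform constant). -/
theorem irnsc_of_anti (hA : AntipodalMirrorDecay) : IRnsc := IRnsc_iff_reflected.2 (irnscRefl_of_anti hA)

/-- **ANTI ⟺ N (PROVED)**: the residual of record of the reduction census IS antipodal mirror decay. -/
theorem anti_iff_irnsc : AntipodalMirrorDecay ↔ IRnsc := ⟨irnsc_of_anti, anti_of_irnsc⟩

/-- **The lens's inductive cut (PROVED): ANTI-BASIN ⇒ ANTI**, by the landed doubling engine `defect_decay_of_recursion` run per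
coupling and species from the entrance scale `S_e(β) ≤ T/a(β)`; rate `c₁ = 1/T`, sizes `S₁(β) = 2⌈T/a(β)⌉`. -/
theorem antipodal_of_basin (hB : AntipodalBasin) : AntipodalMirrorDecay := by
  intro G _ _ _ _ hG hns
  letI : MeasurableSpace G := borel G
  haveI : BorelSpace G := ⟨rfl⟩
  intro r a ha ha0 hlb
  obtain ⟨T, β₂, hT, hA⟩ := hB G hG hns r a ha ha0 hlb
  refine ⟨1 / T, β₂, fun β => 2 * ⌈T / a β⌉₊, by positivity, fun A => ?_⟩
  obtain ⟨C, hC, hent⟩ := hA A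
  refine ⟨C⁻¹, fun β hβ S hS => ?_⟩
  obtain ⟨Se, hSe1, hSeT, hex, hrec⟩ := hent β hβ
  have haβ : 0 < a β := ha β
  have hSeR : (0 : ℝ) < (Se : ℝ) := by exact_mod_cast hSe1
  -- `Se ≤ T / a β ≤ ⌈T / a β⌉`, so `2 Se ≤ S`
  have hSe_le : (Se : ℝ) ≤ T / a β := by rw [le_div_iff₀ haβ]; linarith [mul_comm (a β) (Se : ℝ)]
  have h2Se : 2 * Se ≤ S := by
    have h1 : Se ≤ ⌈T / a β⌉₊ := by exact_mod_cast hSe_le.trans (Nat.le_ceil _)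
    have hS' : 2 * ⌈T / a β⌉₊ ≤ S := hS
    omega
  have hdec := defect_decay_of_recursion (δ := fun L => antip r β A L) (C := C) (L₀ := Se) (Ls := Se) hC
    (fun L hL L' h2 h4 => hrec L hL L' h2 h4) (fun L _ => antip_nonneg r β A L) le_rfl hSe1 hex S h2Se
  refine hdec.trans (mul_le_mul_of_nonneg_left (Real.exp_le_exp.2 ?_) (inv_pos.2 hC).le)
  -- `(S+1)/Se ≥ (1/T) a β S`
  have hS0 : (0 : ℝ) ≤ (S : ℝ) := Nat.cast_nonneg S
  have h1 : 1 / T * a β * (S : ℝ) ≤ ((S : ℝ) + 1) / (Se : ℝ) := by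
    rw [le_div_iff₀ hSeR]
    have h2 : a β * (Se : ℝ) * (S : ℝ) ≤ T * (S : ℝ) := mul_le_mul_of_nonneg_right hSeT hS0
    have h3 : 1 / T * a β * (S : ℝ) * (Se : ℝ) = (a β * (Se : ℝ) * (S : ℝ)) / T := by field_simp
    rw [h3, div_le_iff₀ hT]
    nlinarith
  linarith

/-! ## §4 Compositions (kernel-checked) -/

/-- **N_cof from ANTI (PROVED).** -/
theorem irnscCof_of_anti (hA : AntipodalMirrorDecay) : IRnscCof := irnscCof_of_irnsc (irnsc_of_anti hA)

/-- **The cofinal leaf from the rev-4 bill (PROVED composition):** `IRcof ⇐ (K1 ∧ X) ∧ ANTI`. -/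
theorem IRcof_of_anti (hK1 : CofinalExitAt (1 / 24)) (hX : AFToColdPressure) (hA : AntipodalMirrorDecay) :
    Summit.QuantumFields.YangMills.Theses.BalabanLadder.IRcof :=
  IRcof_of_split (irscCof_of_K1_X hK1 hX) (irnscCof_of_anti hA)

/-- **The cofinal leaf from the lens's inductive cut (PROVED composition):** `IRcof ⇐ (K1 ∧ X) ∧ ANTI-BASIN`. -/
theorem IRcof_of_antipodalBasin (hK1 : CofinalExitAt (1 / 24)) (hX : AFToColdPressure) (hB : AntipodalBasin) :
    Summit.QuantumFields.YangMills.Theses.BalabanLadder.IRcof :=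
  IRcof_of_anti hK1 hX (antipodal_of_basin hB)

/-- **The uniform leaf (19354) from the sc leaf and ANTI (PROVED composition)** — the LEAD's slot {PX, N} with N re-faced. -/
theorem IR_of_sc_anti (hsc : IRsc) (hA : AntipodalMirrorDecay) : Summit.QuantumFields.YangMills.Theses.BalabanLadder.IR :=
  IR_of_cases hsc (irnsc_of_anti hA)

end Summit.QuantumFields.YangMills.Cruxes.IR.AntipodalCode

end
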